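import Literature.Topology.FourManifolds.NormalRetraction
import Literature.Topology.FourManifolds.RegularValuePreimage
import Mathlib.Geometry.Manifold.Instances.Real
import HarnessLib

/-!
# The submersive locus of a smooth map into Euclidean space is open

Topic `Literature/Topology/Immersions`; general differential topology (Hirsch, *Differential
Topology* (1976), Ch. 1 §3, before Thm. 3.2: *"the set of regular points of `f` is open"* —
the rank of the differential is lower semicontinuous). For a `C^∞` map `F : V → ℝ^q` on a
manifold `V` modelled on `ℝᵐ`,

* `surjective_mfderiv_iff_chartDeriv` — at a point `x` of the chart domain of `p`, `dF_x` is
  onto iff the chart derivative `D(F ∘ φₚ⁻¹)(φₚ x)` is (they differ by the invertible `dφₚ`);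
* `isOpen_setOf_surjective_mfderiv` — **`{v | dF_v onto}` is open**: in a chart the condition
  reads through the continuous family of chart derivatives
  (`Literature.Topology.FourManifolds.contDiffOn_chartDeriv`), and surjectivity of a continuous
  family of linear maps is an open condition
  (`Literature.Topology.FourManifolds.isOpen_inter_setOf_surjective`).

This is the openness input of the regular preimage theorem for maps that are submersive only
near a level (e.g. the double-point equation `f x = f y` of a self-transverse immersion).

Everything here is proved; no definitions, no named facts.

## References

* M. W. Hirsch, *Differential Topology*, GTM 33 (1976), Ch. 1 §3 (regular points form an open
  set), Thm. 3.2. [HirschDT1976]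
-/

open scoped Manifold ContDiff Topology
open Set Function

noncomputable section

namespace Literature.Topology.Immersions

/-- Local notation: `𝔼 n` is the model Euclidean space `EuclideanSpace ℝ (Fin n)`. -/
local notation "𝔼 " n:arg => EuclideanSpace ℝ (Fin n)

open Literature.Topology.FourManifolds (chartDeriv mfderiv_eq_chartDeriv_comp contDiffOn_chartDeriv
  isOpen_inter_setOf_surjective)

variable {m q : ℕ} {V : Type*} [TopologicalSpace V] [ChartedSpace (𝔼 m) V]
  [IsManifold (𝓡 m) ∞ V] {F : V → 𝔼 q}

/-- **Onto differential, read in a chart**: for `x` in the domain of the extended chart at `p`,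
`dF_x` is onto iff the chart derivative `D(F ∘ φₚ⁻¹)(φₚ x)` is onto. [folklore] -/
theorem surjective_mfderiv_iff_chartDeriv (hF : ContMDiff (𝓡 m) (𝓡 q) ∞ F) (p : V) {x : V}
    (hx : x ∈ (extChartAt (𝓡 m) p).source) :
    Surjective (mfderiv (𝓡 m) (𝓡 q) F x) ↔
      Surjective (chartDeriv (𝓡 m) F p (extChartAt (𝓡 m) p x)) := by
  have hFx : MDifferentiableAt (𝓡 m) (𝓡 q) F x := (hF x).mdifferentiableAt (by simp)
  have heq := mfderiv_eq_chartDeriv_comp (I := 𝓡 m) hx hFx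
  have hinv := isInvertible_mfderiv_extChartAt (I := 𝓡 m) hx
  have hfun : (mfderiv (𝓡 m) (𝓡 q) F x : 𝔼 m → 𝔼 q) =
      chartDeriv (𝓡 m) F p (extChartAt (𝓡 m) p x) ∘
        mfderiv (𝓡 m) 𝓘(ℝ, 𝔼 m) (extChartAt (𝓡 m) p) x := by
    rw [heq]
    rfl
  rw [hfun]
  constructor
  · exact fun h => h.of_comp
  · exact fun h => h.comp hinv.surjective

/-- **The submersive locus is open**: for a `C^∞` map `F : V → ℝ^q` the set of points where
`dF` is onto is open. [cite: HirschDT1976, Ch. 1 §3] -/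
theorem isOpen_setOf_surjective_mfderiv (hF : ContMDiff (𝓡 m) (𝓡 q) ∞ F) :
    IsOpen {v : V | Surjective (mfderiv (𝓡 m) (𝓡 q) F v)} := by
  rw [isOpen_iff_forall_mem_open]
  intro p hp
  set φ := extChartAt (𝓡 m) p with hφ
  -- the open set of good chart points
  have hT : IsOpen {y ∈ φ.target | Surjective (chartDeriv (𝓡 m) F p y)} :=
    isOpen_inter_setOf_surjective (isOpen_extChartAt_target p)
      (contDiffOn_chartDeriv (I := 𝓡 m) hF p).continuousOn
  have hO : IsOpen (φ.source ∩ φ ⁻¹' {y ∈ φ.target | Surjective (chartDeriv (𝓡 m) F p y)}) :=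
    (continuousOn_extChartAt p).isOpen_inter_preimage (isOpen_extChartAt_source p) hT
  refine ⟨φ.source ∩ φ ⁻¹' {y ∈ φ.target | Surjective (chartDeriv (𝓡 m) F p y)}, ?_, hO, ?_⟩
  · rintro x ⟨hx, -, hsx⟩
    exact (surjective_mfderiv_iff_chartDeriv hF p hx).2 hsx
  · refine ⟨mem_extChartAt_source p, φ.map_source (mem_extChartAt_source p), ?_⟩
    exact (surjective_mfderiv_iff_chartDeriv hF p (mem_extChartAt_source p)).1 hp

end Literature.Topology.Immersions
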